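import Summits.BirchSwinnertonDyer.Rank1Residual.X10.SelfTwistPartialAgreement
import Summits.BirchSwinnertonDyer.Rank1Residual.X10.SelfTwistVisibleGoodAtThreeRecordsA
import Summits.BirchSwinnertonDyer.Rank1Residual.X10.SelfTwistVisibleGoodAtThreeRecordsB
import Summits.BirchSwinnertonDyer.Rank1Residual.X10.SelfTwistVisibleGoodAtThreeRecordsC
import Summits.BirchSwinnertonDyer.Rank1Residual.GaloisImage.PadicTwistClassDecider
import HarnessLib

/-!
# N2 (X10b @ 3): SELF-TWIST visibility records UNCONDITIONAL at `3` (x10 GEN 22's partial agreement, no `hMR`) —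
# `55696n1` (twin `55696o1`), `110224f1` (twin `110224g1`), `183184b1` (twin `183184a1`)
# (cell `b2b-bsdres`, unit `b2b-bsdres-x10` = N2 class lead, GEN 22; per-pair RECORDS, close nothing)

HONEST FRAMING (cell `b2b-bsdres`, run/shared/lean/b2b/bsd-rank1-residual/, verbatim in every
file): the goal of the cell is to DELETE the COMBINATION-SHAPED residual classes of the
Birch–Swinnerton-Dyer formula for ALL analytic-rank `≤ 1` elliptic curves over `ℚ` — "full BSD
formula for every rank `≤ 1` curve in class `C`" assembled STRICTLY from published theorems — so
that the rank-`≤ 1` remainder becomes exactly the CONSTRUCTION-SHAPED classes, which are TYPED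
(missing-input `Prop`s), NOT attempted. This is not "finishing BSD". Class X10b (= N2) stays
CONSTRUCTION-SHAPED (NEEDS `X_A3`); this file holds PER-PAIR RECORDS of the LOWER half only; nothing is
booked; no mark / label / tier / count is changed. Theorems only (no definition, no named fact of ours,
no `sorry`).

## What

The seven ANOMALOUS N2 self-twist Ш-cells (`40898d 55696l 55696n 110224f 183184b 327184dt 395641f`; x10
GEN 21 `SELF-TWIST-LAW.md`, GEN 22 `X10/SelfTwistVisibleGoodAtThree{,RecordsA,B,C}.lean`) re-derived
WITHOUT the Mazur–Rubin named fact `hMR`: by x10 GEN 22's UNCONDITIONAL partial agreement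
`SelfTwist.relIndex_map_selmerLocalKer_le_card_quot_of_hasGoodReductionAt`
(`X10/SelfTwistPartialAgreement.lean`: at a both-good place `ι_v(θ) ≤ #(𝓞_v/p)`, Milne *ADT* I 3.8 DISCHARGED in
the tree) the place `3` costs `3` and the twin's rank `2` pays for it (`1·3 < 9`; socket
`exists_sha_ne_zero_three_of_congr_goodAtThree_rankTwo[_mult]_of_primeList`).  Per record:
`∃ c ∈ Ш(E), c ≠ 0, 3c = 0`; `3² ∣ #Ш(E)[3^∞]` (`hCT`); the typed LOWER binder `MissingLowerBoundAt W 3`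
(`hq`).  Every local binder IN THE KERNEL, re-using the numerals and TamLocal certificates landed with the
kind-(v) records (x10 GEN 12 point counts, `noroot3_frob_*`, `tamLocal_check_*`, F2d minimality).
BINDERS LEFT (displayed, EVIDENCE columns — nothing booked): `hCT`, `hGZK`, `hr : r_an(E) = 0` (Cremona),
`θ : E′[3] ≃ E[3]` with `hθ` (the self-twist congruence; EVIDENCE: cc-eng-2 KO-certified
`class-closure/N2/CONG-certified-eng2.tsv`, kit j123296), `hrank : 2 ≤ rank E′(ℚ)` (Cremona `allgens`),
`hq` (`#Ш_an`); `hU2` (Tate uniformisation) for `40898d1` only (place `2` of kind (iii)).  NO `hMR`.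

References: [MilneADT2006] I Prop. 3.8, Lemma 2.9, Lemma 3.3; [CremonaMazur2000] §3; [AgasheStein2002]
Thm. 3.1; [Mazur1978] Prop. 6.3 (1); [SilvermanATAEC1994] IV.9.4, V.5.3–5.4; [SilvermanAEC2009] VII.5.1,
X.4.14; [Kraus1989] Prop. 2; [Cremona2006] Table 1.
-/

set_option autoImplicit false

noncomputable section

open scoped Classical NumberField
open IsDedekindDomain NumberField WeierstrassCurve Rat.HeightOneSpectrum
  Literature.NumberTheory.EllipticCurves Literature.NumberTheory.EllipticCurves.ModularForms
  Literature.NumberTheory.EllipticCurves.Rank1Residual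
  Literature.NumberTheory.EllipticCurves.Rank1Residual.Typed
  Literature.NumberTheory.GaloisRepresentations
  Summit.BirchSwinnertonDyer.BirchSwinnertonDyer.Rank1Residual.IntModel
  Summit.BirchSwinnertonDyer.BirchSwinnertonDyer.Rank1Residual.X11RankOne
  Summit.BirchSwinnertonDyer.BirchSwinnertonDyer.Rank2Observatory
  Summit.BirchSwinnertonDyer.BirchSwinnertonDyer.Rank2Observatory.Tam
  Summit.BirchSwinnertonDyer.Rank1Residual.GaloisImage
  Summit.BirchSwinnertonDyer.Rank1Residual.GaloisImage.LocalTorsion3At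
  Summit.BirchSwinnertonDyer.Rank1Residual.Additive
  Summit.BirchSwinnertonDyer.Rank1Residual.X11b

namespace Summit.BirchSwinnertonDyer.Rank1Residual.X10.SelfTwist

/-! ### Record `55696n1`, unconditional at `3` (twin `55696o1`; `N = 55696 = 2⁴·59²`, `d* = -59`, `#Ш_an(E) = 9`) -/
/-- **SELF-TWIST VISIBILITY RECORD, UNCONDITIONAL AT `3` (closes nothing, moves no mark): a non-zero
`3`-torsion element of `Ш(E/ℚ)` for `E = 55696n1` from its rank-2 self-twist `E′ = 55696o1 = E ⊗ χ_{-59}`**,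
both curves GOOD ORDINARY and ANOMALOUS at `3` — the place `3` costs `ι₃(θ) ≤ #(ℤ₃/3) = 3 < 9 ≤ 3^rank` by x10
GEN 22's partial agreement `SelfTwist.relIndex_map_selmerLocalKer_le_card_quot_of_hasGoodReductionAt` (NO named
fact; Milne I.3.8 discharged in the tree); the other places of `S` = places over `[2, 3, 59]` are additive for
`E′` with `E′(ℚ_ℓ)[3] = 0` (kind (i), TamLocal certificates in the kernel: `2` (Kodaira I*ₙ, value set {2,4}), `59` (type III, c = 2)); `E[3]` irreducible from
the Frobenius witness `ℓ = 13` (`#Ẽ(𝔽_{13}) = 11`); needs `rank E′ ≥ 2` (Cremona: `2`). Supersedes the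
kind-(v) record `exists_sha_three_selfTwist_v55696n1` (conditional on Mazur–Rubin `hMR`, rank `≥ 1`).
[cite: MilneADT2006, Ch. I Prop. 3.8 and Lemma 2.9] [cite: CremonaMazur2000, §3 and Table 1]
[cite: Mazur1978, §6 Prop. 6.3 (1) (p. 153)] [cite: Cremona2006, Table 1 (labels 55696n1, 55696o1)] -/
theorem exists_sha_three_selfTwist_uncond_v55696n1
    (hGZK : rank_eq_analyticRank_of_analyticRank_le_one)
    (W : WeierstrassCurve ℚ) [W.IsElliptic] [W.IsGloballyMinimal]
    (hI : integralModelInt W = ⟨0, 1, 0, (-2396088), (-1642476716)⟩) (hr : W.analyticRank = 0)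
    (W' : WeierstrassCurve ℚ) (hW' : W' = ⟨0, 1, 0, (-688), 7764⟩) [W'.IsElliptic]
    (θ : geomTorsion W' ((3 : ℕ) : ℤ) ≃+ geomTorsion W ((3 : ℕ) : ℤ))
    (hθ : ∀ (σ : Field.absoluteGaloisGroup ℚ) (P : geomTorsion W' ((3 : ℕ) : ℤ)), θ (σ • P) = σ • θ P)
    (hrank : 2 ≤ W'.mordellWeilRank) :
    ∃ c : W.sha, c ≠ 0 ∧ 3 • c = 0 := by
  haveI : Fact (Nat.Prime 3) := ⟨Nat.prime_three⟩
  haveI : Fact (Nat.Prime 2) := ⟨by norm_num⟩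
  haveI : Fact (Nat.Prime 13) := ⟨by norm_num⟩
  haveI : Fact (Nat.Prime 59) := ⟨by norm_num⟩
  -- the row `55696n1`: `E(ℚ)` finite of order prime to `3`
  have hfin : Finite W.toAffine.Point := finite_point_of_analyticRank_eq_zero W hGZK hr
  have hirr : W.HasIrreducibleModPGaloisRep 3 :=
    hasIrreducibleModPGaloisRep_of_intModel_of_noroot hI 3 13 (by norm_num) (by decide +kernel)
      Summit.BirchSwinnertonDyer.Rank1Residual.X10.card_t55696n1_13 noroot3_frob_13_11
  have hcop : (Nat.card W.toAffine.Point).Coprime 3 := coprime_natCard_point_of_irr W 3 hirr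
  have hE : (⟨0, 1, 0, (-2396088), (-1642476716)⟩ : WeierstrassCurve ℤ).map (Int.castRingHom ℚ) = W := by
    rw [IntModelTam.eq_baseChange_of_integralModelInt hI]; rfl
  -- the partner `55696o1`: globally minimal, integral model
  have hM' : W'.IsGloballyMinimal := by
    rw [hW']
    exact Summit.BirchSwinnertonDyer.Rank1Residual.X10.isGloballyMinimal_of_krausCriterion_bounded₃ 0 1 0 (-688) 7764
      (by decide +kernel) (by decide +kernel) (by decide +kernel) (by decide +kernel)
  have hI' : integralModelInt W' = ⟨0, 1, 0, (-688), 7764⟩ := by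
    subst hW'; exact integralModelInt_eq_of_map_eq _ (map_mk_int 0 1 0 (-688) 7764)
  have hF : (⟨0, 1, 0, (-688), 7764⟩ : WeierstrassCurve ℤ).map (Int.castRingHom ℚ) = W' := by
    rw [hW']; exact map_mk_int 0 1 0 (-688) 7764
  -- prime support of the two discriminants
  have hΔE : ∀ q : ℕ, q.Prime → (q : ℤ) ∣ (⟨0, 1, 0, (-2396088), (-1642476716)⟩ : WeierstrassCurve ℤ).Δ → q ∈ [2, 3, 59] :=
    X11b.forall_mem_of_natAbs_eq_prod_pow [2, 3, 59] [15, 0, 9]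
      (by intro q hq; simp only [List.mem_cons, List.mem_nil_iff, or_false] at hq; rcases hq with rfl | rfl | rfl <;> norm_num)
      (by decide +kernel)
  have hΔF : ∀ q : ℕ, q.Prime → (q : ℤ) ∣ (⟨0, 1, 0, (-688), 7764⟩ : WeierstrassCurve ℤ).Δ → q ∈ [2, 3, 59] :=
    X11b.forall_mem_of_natAbs_eq_prod_pow [2, 3, 59] [15, 0, 3]
      (by intro q hq; simp only [List.mem_cons, List.mem_nil_iff, or_false] at hq; rcases hq with rfl | rfl | rfl <;> norm_num)
      (by decide +kernel)
  refine exists_sha_ne_zero_three_of_congr_goodAtThree_rankTwo_of_primeList W W' θ hθ hE hF [2, 3, 59] (by simp)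
    hΔE hΔF
    (by decide +kernel) (by decide +kernel) hfin hcop hrank (fun v hvL hv3 ↦ ?_)
  simp only [List.mem_cons, List.mem_nil_iff, or_false] at hvL
  rcases hvL with h2 | h3 | h59
  · -- `v = 2`: additive Kodaira I*ₙ, value set {2,4}
    exact LocalTorsionAway.natCard_ker_nsmul_adicCompletion_eq_one_of_intModel_of_additive_tamLocal_forall hI' 2 3
      (by norm_num) h2 (by decide) (by decide) (E := ⟨2, 1, 5, 0, 2, 1, 16, 15, 71, 3, 4⟩) rfl
      tamLocal_check_55696o1_2 (by decide)
  · exact absurd h3 hv3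
  · -- `v = 59`: additive type III, `c = 2`
    exact LocalTorsionAway.natCard_ker_nsmul_adicCompletion_eq_one_of_intModel_of_additive hI' 59 3 (by norm_num) h59
      (by decide) (by decide)
      (IntModelTam.localTamagawaNumber_padic_eq_of_intModel_of_tamLocal hI' 59 (E := ⟨59, 7, 4, 0, 39, 0, 0, 3, 3, 2, 2⟩)
        rfl tamLocal_check_55696o1_59 (c := 2) (by decide)) (by norm_num)

/-- **`3² ∣ #Ш(55696n1)[3^∞]`** from the visible element (unconditional at `3`) and the Cassels–Tate parity (`hCT`).
[cite: SilvermanAEC2009, Thm. X.4.14] [cite: MilneADT2006, Ch. I Prop. 3.8] -/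
theorem sq_dvd_card_sha_three_selfTwist_uncond_v55696n1
    (hCT : exists_casselsTate_pairing (K := ℚ))
    (hGZK : rank_eq_analyticRank_of_analyticRank_le_one)
    (W : WeierstrassCurve ℚ) [W.IsElliptic] [W.IsGloballyMinimal]
    (hI : integralModelInt W = ⟨0, 1, 0, (-2396088), (-1642476716)⟩) (hr : W.analyticRank = 0)
    (W' : WeierstrassCurve ℚ) (hW' : W' = ⟨0, 1, 0, (-688), 7764⟩) [W'.IsElliptic]
    (θ : geomTorsion W' ((3 : ℕ) : ℤ) ≃+ geomTorsion W ((3 : ℕ) : ℤ))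
    (hθ : ∀ (σ : Field.absoluteGaloisGroup ℚ) (P : geomTorsion W' ((3 : ℕ) : ℤ)), θ (σ • P) = σ • θ P)
    (hrank : 2 ≤ W'.mordellWeilRank) :
    3 ^ 2 ∣ Nat.card (AddCommGroup.primaryComponent W.sha 3) := by
  haveI : Finite W.sha := (hGZK W (by rw [hr]; exact zero_le_one)).2
  exact Visible.sq_dvd_card_sha_three_of_exists_sha_torsion hCT W
    (exists_sha_three_selfTwist_uncond_v55696n1 hGZK W hI hr W' hW' θ hθ hrank)

/-- **The typed LOWER binder `MissingLowerBoundAt E 3` for `55696n1`** (`ord₃ #Ш_an ≤ ord₃ #Ш`) from the visible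
`3`-torsion element, the Cassels–Tate squareness and the analytic datum `#Ш_an = 9` (`hq`, Cremona `allbsd`;
evidence binder). Conditional on `hCT` only at this step. [cite: SilvermanAEC2009, Thm. X.4.14] [cite: Cremona2006, Table 1 (label 55696n1)] -/
theorem missingLowerBoundAt_three_selfTwist_uncond_v55696n1
    (hCT : exists_casselsTate_pairing (K := ℚ))
    (hGZK : rank_eq_analyticRank_of_analyticRank_le_one)
    (W : WeierstrassCurve ℚ) [W.IsElliptic] [W.IsGloballyMinimal]
    (hI : integralModelInt W = ⟨0, 1, 0, (-2396088), (-1642476716)⟩) (hr : W.analyticRank = 0)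
    {q : ℚ} (hq : shaAn W = (q : ℂ)) (hv : padicValRat 3 q ≤ 2)
    (W' : WeierstrassCurve ℚ) (hW' : W' = ⟨0, 1, 0, (-688), 7764⟩) [W'.IsElliptic]
    (θ : geomTorsion W' ((3 : ℕ) : ℤ) ≃+ geomTorsion W ((3 : ℕ) : ℤ))
    (hθ : ∀ (σ : Field.absoluteGaloisGroup ℚ) (P : geomTorsion W' ((3 : ℕ) : ℤ)), θ (σ • P) = σ • θ P)
    (hrank : 2 ≤ W'.mordellWeilRank) :
    haveI : Fact (Nat.Prime 3) := ⟨Nat.prime_three⟩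
    MissingLowerBoundAt W 3 := by
  haveI : Fact (Nat.Prime 3) := ⟨Nat.prime_three⟩
  have hvis := exists_sha_three_selfTwist_uncond_v55696n1 hGZK W hI hr W' hW' θ hθ hrank
  exact missingLowerBoundAt_of_casselsTate_of_pow_dvd W 3 hCT (hGZK W (by rw [hr]; exact zero_le_one)).2 hq
    (k := 1) (by simpa using hv) (by simpa using dvd_shaOrder_of_exists_torsion W 3 hvis)

/-! ### Record `110224f1`, unconditional at `3` (twin `110224g1`; `N = 110224 = 2⁴·83²`, `d* = -83`, `#Ш_an(E) = 9`) -/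
/-- **SELF-TWIST VISIBILITY RECORD, UNCONDITIONAL AT `3` (closes nothing, moves no mark): a non-zero
`3`-torsion element of `Ш(E/ℚ)` for `E = 110224f1` from its rank-2 self-twist `E′ = 110224g1 = E ⊗ χ_{-83}`**,
both curves GOOD ORDINARY and ANOMALOUS at `3` — the place `3` costs `ι₃(θ) ≤ #(ℤ₃/3) = 3 < 9 ≤ 3^rank` by x10
GEN 22's partial agreement `SelfTwist.relIndex_map_selmerLocalKer_le_card_quot_of_hasGoodReductionAt` (NO named
fact; Milne I.3.8 discharged in the tree); the other places of `S` = places over `[2, 3, 83]` are additive for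
`E′` with `E′(ℚ_ℓ)[3] = 0` (kind (i), TamLocal certificates in the kernel: `2` (Kodaira I*ₙ, value set {2,4}), `83` (type III, c = 2)); `E[3]` irreducible from
the Frobenius witness `ℓ = 13` (`#Ẽ(𝔽_{13}) = 8`); needs `rank E′ ≥ 2` (Cremona: `2`). Supersedes the
kind-(v) record `exists_sha_three_selfTwist_v110224f1` (conditional on Mazur–Rubin `hMR`, rank `≥ 1`).
[cite: MilneADT2006, Ch. I Prop. 3.8 and Lemma 2.9] [cite: CremonaMazur2000, §3 and Table 1]
[cite: Mazur1978, §6 Prop. 6.3 (1) (p. 153)] [cite: Cremona2006, Table 1 (labels 110224f1, 110224g1)] -/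
theorem exists_sha_three_selfTwist_uncond_v110224f1
    (hGZK : rank_eq_analyticRank_of_analyticRank_le_one)
    (W : WeierstrassCurve ℚ) [W.IsElliptic] [W.IsGloballyMinimal]
    (hI : integralModelInt W = ⟨0, 1, 0, (-6670848), (-12548797516)⟩) (hr : W.analyticRank = 0)
    (W' : WeierstrassCurve ℚ) (hW' : W' = ⟨0, 1, 0, (-968), 21620⟩) [W'.IsElliptic]
    (θ : geomTorsion W' ((3 : ℕ) : ℤ) ≃+ geomTorsion W ((3 : ℕ) : ℤ))
    (hθ : ∀ (σ : Field.absoluteGaloisGroup ℚ) (P : geomTorsion W' ((3 : ℕ) : ℤ)), θ (σ • P) = σ • θ P)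
    (hrank : 2 ≤ W'.mordellWeilRank) :
    ∃ c : W.sha, c ≠ 0 ∧ 3 • c = 0 := by
  haveI : Fact (Nat.Prime 3) := ⟨Nat.prime_three⟩
  haveI : Fact (Nat.Prime 2) := ⟨by norm_num⟩
  haveI : Fact (Nat.Prime 13) := ⟨by norm_num⟩
  haveI : Fact (Nat.Prime 83) := ⟨by norm_num⟩
  -- the row `110224f1`: `E(ℚ)` finite of order prime to `3`
  have hfin : Finite W.toAffine.Point := finite_point_of_analyticRank_eq_zero W hGZK hr
  have hirr : W.HasIrreducibleModPGaloisRep 3 :=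
    hasIrreducibleModPGaloisRep_of_intModel_of_noroot hI 3 13 (by norm_num) (by decide +kernel)
      Summit.BirchSwinnertonDyer.Rank1Residual.X10.card_t110224f1_13 noroot3_frob_13_8
  have hcop : (Nat.card W.toAffine.Point).Coprime 3 := coprime_natCard_point_of_irr W 3 hirr
  have hE : (⟨0, 1, 0, (-6670848), (-12548797516)⟩ : WeierstrassCurve ℤ).map (Int.castRingHom ℚ) = W := by
    rw [IntModelTam.eq_baseChange_of_integralModelInt hI]; rfl
  -- the partner `110224g1`: globally minimal, integral model
  have hM' : W'.IsGloballyMinimal := by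
    rw [hW']
    exact Summit.BirchSwinnertonDyer.Rank1Residual.X10.isGloballyMinimal_of_krausCriterion_bounded₃ 0 1 0 (-968) 21620
      (by decide +kernel) (by decide +kernel) (by decide +kernel) (by decide +kernel)
  have hI' : integralModelInt W' = ⟨0, 1, 0, (-968), 21620⟩ := by
    subst hW'; exact integralModelInt_eq_of_map_eq _ (map_mk_int 0 1 0 (-968) 21620)
  have hF : (⟨0, 1, 0, (-968), 21620⟩ : WeierstrassCurve ℤ).map (Int.castRingHom ℚ) = W' := by
    rw [hW']; exact map_mk_int 0 1 0 (-968) 21620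
  -- prime support of the two discriminants
  have hΔE : ∀ q : ℕ, q.Prime → (q : ℤ) ∣ (⟨0, 1, 0, (-6670848), (-12548797516)⟩ : WeierstrassCurve ℤ).Δ → q ∈ [2, 3, 83] :=
    X11b.forall_mem_of_natAbs_eq_prod_pow [2, 3, 83] [18, 0, 9]
      (by intro q hq; simp only [List.mem_cons, List.mem_nil_iff, or_false] at hq; rcases hq with rfl | rfl | rfl <;> norm_num)
      (by decide +kernel)
  have hΔF : ∀ q : ℕ, q.Prime → (q : ℤ) ∣ (⟨0, 1, 0, (-968), 21620⟩ : WeierstrassCurve ℤ).Δ → q ∈ [2, 3, 83] :=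
    X11b.forall_mem_of_natAbs_eq_prod_pow [2, 3, 83] [18, 0, 3]
      (by intro q hq; simp only [List.mem_cons, List.mem_nil_iff, or_false] at hq; rcases hq with rfl | rfl | rfl <;> norm_num)
      (by decide +kernel)
  refine exists_sha_ne_zero_three_of_congr_goodAtThree_rankTwo_of_primeList W W' θ hθ hE hF [2, 3, 83] (by simp)
    hΔE hΔF
    (by decide +kernel) (by decide +kernel) hfin hcop hrank (fun v hvL hv3 ↦ ?_)
  simp only [List.mem_cons, List.mem_nil_iff, or_false] at hvL
  rcases hvL with h2 | h3 | h83
  · -- `v = 2`: additive Kodaira I*ₙ, value set {2,4}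
    exact LocalTorsionAway.natCard_ker_nsmul_adicCompletion_eq_one_of_intModel_of_additive_tamLocal_forall hI' 2 3
      (by norm_num) h2 (by decide) (by decide) (E := ⟨2, 1, 5, 0, 30, 1, 64, 18, 72, 4, 4⟩) rfl
      tamLocal_check_110224g1_2 (by decide)
  · exact absurd h3 hv3
  · -- `v = 83`: additive type III, `c = 2`
    exact LocalTorsionAway.natCard_ker_nsmul_adicCompletion_eq_one_of_intModel_of_additive hI' 83 3 (by norm_num) h83
      (by decide) (by decide)
      (IntModelTam.localTamagawaNumber_padic_eq_of_intModel_of_tamLocal hI' 83 (E := ⟨83, 9, 4, 0, 55, 0, 0, 3, 3, 2, 2⟩)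
        rfl tamLocal_check_110224g1_83 (c := 2) (by decide)) (by norm_num)

/-- **`3² ∣ #Ш(110224f1)[3^∞]`** from the visible element (unconditional at `3`) and the Cassels–Tate parity (`hCT`).
[cite: SilvermanAEC2009, Thm. X.4.14] [cite: MilneADT2006, Ch. I Prop. 3.8] -/
theorem sq_dvd_card_sha_three_selfTwist_uncond_v110224f1
    (hCT : exists_casselsTate_pairing (K := ℚ))
    (hGZK : rank_eq_analyticRank_of_analyticRank_le_one)
    (W : WeierstrassCurve ℚ) [W.IsElliptic] [W.IsGloballyMinimal]
    (hI : integralModelInt W = ⟨0, 1, 0, (-6670848), (-12548797516)⟩) (hr : W.analyticRank = 0)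
    (W' : WeierstrassCurve ℚ) (hW' : W' = ⟨0, 1, 0, (-968), 21620⟩) [W'.IsElliptic]
    (θ : geomTorsion W' ((3 : ℕ) : ℤ) ≃+ geomTorsion W ((3 : ℕ) : ℤ))
    (hθ : ∀ (σ : Field.absoluteGaloisGroup ℚ) (P : geomTorsion W' ((3 : ℕ) : ℤ)), θ (σ • P) = σ • θ P)
    (hrank : 2 ≤ W'.mordellWeilRank) :
    3 ^ 2 ∣ Nat.card (AddCommGroup.primaryComponent W.sha 3) := by
  haveI : Finite W.sha := (hGZK W (by rw [hr]; exact zero_le_one)).2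
  exact Visible.sq_dvd_card_sha_three_of_exists_sha_torsion hCT W
    (exists_sha_three_selfTwist_uncond_v110224f1 hGZK W hI hr W' hW' θ hθ hrank)

/-- **The typed LOWER binder `MissingLowerBoundAt E 3` for `110224f1`** (`ord₃ #Ш_an ≤ ord₃ #Ш`) from the visible
`3`-torsion element, the Cassels–Tate squareness and the analytic datum `#Ш_an = 9` (`hq`, Cremona `allbsd`;
evidence binder). Conditional on `hCT` only at this step. [cite: SilvermanAEC2009, Thm. X.4.14] [cite: Cremona2006, Table 1 (label 110224f1)] -/
theorem missingLowerBoundAt_three_selfTwist_uncond_v110224f1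
    (hCT : exists_casselsTate_pairing (K := ℚ))
    (hGZK : rank_eq_analyticRank_of_analyticRank_le_one)
    (W : WeierstrassCurve ℚ) [W.IsElliptic] [W.IsGloballyMinimal]
    (hI : integralModelInt W = ⟨0, 1, 0, (-6670848), (-12548797516)⟩) (hr : W.analyticRank = 0)
    {q : ℚ} (hq : shaAn W = (q : ℂ)) (hv : padicValRat 3 q ≤ 2)
    (W' : WeierstrassCurve ℚ) (hW' : W' = ⟨0, 1, 0, (-968), 21620⟩) [W'.IsElliptic]
    (θ : geomTorsion W' ((3 : ℕ) : ℤ) ≃+ geomTorsion W ((3 : ℕ) : ℤ))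
    (hθ : ∀ (σ : Field.absoluteGaloisGroup ℚ) (P : geomTorsion W' ((3 : ℕ) : ℤ)), θ (σ • P) = σ • θ P)
    (hrank : 2 ≤ W'.mordellWeilRank) :
    haveI : Fact (Nat.Prime 3) := ⟨Nat.prime_three⟩
    MissingLowerBoundAt W 3 := by
  haveI : Fact (Nat.Prime 3) := ⟨Nat.prime_three⟩
  have hvis := exists_sha_three_selfTwist_uncond_v110224f1 hGZK W hI hr W' hW' θ hθ hrank
  exact missingLowerBoundAt_of_casselsTate_of_pow_dvd W 3 hCT (hGZK W (by rw [hr]; exact zero_le_one)).2 hq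
    (k := 1) (by simpa using hv) (by simpa using dvd_shaOrder_of_exists_torsion W 3 hvis)

/-! ### Record `183184b1`, unconditional at `3` (twin `183184a1`; `N = 183184 = 2⁴·107²`, `d* = -107`, `#Ш_an(E) = 9`) -/
/-- **SELF-TWIST VISIBILITY RECORD, UNCONDITIONAL AT `3` (closes nothing, moves no mark): a non-zero
`3`-torsion element of `Ш(E/ℚ)` for `E = 183184b1` from its rank-2 self-twist `E′ = 183184a1 = E ⊗ χ_{-107}`**,
both curves GOOD ORDINARY and ANOMALOUS at `3` — the place `3` costs `ι₃(θ) ≤ #(ℤ₃/3) = 3 < 9 ≤ 3^rank` by x10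
GEN 22's partial agreement `SelfTwist.relIndex_map_selmerLocalKer_le_card_quot_of_hasGoodReductionAt` (NO named
fact; Milne I.3.8 discharged in the tree); the other places of `S` = places over `[2, 3, 107]` are additive for
`E′` with `E′(ℚ_ℓ)[3] = 0` (kind (i), TamLocal certificates in the kernel: `2` (Kodaira I*ₙ, value set {2,4}), `107` (type III, c = 2)); `E[3]` irreducible from
the Frobenius witness `ℓ = 7` (`#Ẽ(𝔽_{7}) = 8`); needs `rank E′ ≥ 2` (Cremona: `2`). Supersedes the
kind-(v) record `exists_sha_three_selfTwist_v183184b1` (conditional on Mazur–Rubin `hMR`, rank `≥ 1`).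
[cite: MilneADT2006, Ch. I Prop. 3.8 and Lemma 2.9] [cite: CremonaMazur2000, §3 and Table 1]
[cite: Mazur1978, §6 Prop. 6.3 (1) (p. 153)] [cite: Cremona2006, Table 1 (labels 183184b1, 183184a1)] -/
theorem exists_sha_three_selfTwist_uncond_v183184b1
    (hGZK : rank_eq_analyticRank_of_analyticRank_le_one)
    (W : WeierstrassCurve ℚ) [W.IsElliptic] [W.IsGloballyMinimal]
    (hI : integralModelInt W = ⟨0, 1, 0, (-4491824), (-94543873196)⟩) (hr : W.analyticRank = 0)
    (W' : WeierstrassCurve ℚ) (hW' : W' = ⟨0, 1, 0, (-392), 77044⟩) [W'.IsElliptic]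
    (θ : geomTorsion W' ((3 : ℕ) : ℤ) ≃+ geomTorsion W ((3 : ℕ) : ℤ))
    (hθ : ∀ (σ : Field.absoluteGaloisGroup ℚ) (P : geomTorsion W' ((3 : ℕ) : ℤ)), θ (σ • P) = σ • θ P)
    (hrank : 2 ≤ W'.mordellWeilRank) :
    ∃ c : W.sha, c ≠ 0 ∧ 3 • c = 0 := by
  haveI : Fact (Nat.Prime 3) := ⟨Nat.prime_three⟩
  haveI : Fact (Nat.Prime 2) := ⟨by norm_num⟩
  haveI : Fact (Nat.Prime 7) := ⟨by norm_num⟩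
  haveI : Fact (Nat.Prime 107) := ⟨by norm_num⟩
  -- the row `183184b1`: `E(ℚ)` finite of order prime to `3`
  have hfin : Finite W.toAffine.Point := finite_point_of_analyticRank_eq_zero W hGZK hr
  have hirr : W.HasIrreducibleModPGaloisRep 3 :=
    hasIrreducibleModPGaloisRep_of_intModel_of_noroot hI 3 7 (by norm_num) (by decide +kernel)
      Summit.BirchSwinnertonDyer.Rank1Residual.X10.card_t183184b1_7 noroot3_frob_7_8
  have hcop : (Nat.card W.toAffine.Point).Coprime 3 := coprime_natCard_point_of_irr W 3 hirr
  have hE : (⟨0, 1, 0, (-4491824), (-94543873196)⟩ : WeierstrassCurve ℤ).map (Int.castRingHom ℚ) = W := by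
    rw [IntModelTam.eq_baseChange_of_integralModelInt hI]; rfl
  -- the partner `183184a1`: globally minimal, integral model
  have hM' : W'.IsGloballyMinimal := by
    rw [hW']
    exact Summit.BirchSwinnertonDyer.Rank1Residual.X10.isGloballyMinimal_of_krausCriterion_bounded₃ 0 1 0 (-392) 77044
      (by decide +kernel) (by decide +kernel) (by decide +kernel) (by decide +kernel)
  have hI' : integralModelInt W' = ⟨0, 1, 0, (-392), 77044⟩ := by
    subst hW'; exact integralModelInt_eq_of_map_eq _ (map_mk_int 0 1 0 (-392) 77044)
  have hF : (⟨0, 1, 0, (-392), 77044⟩ : WeierstrassCurve ℤ).map (Int.castRingHom ℚ) = W' := by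
    rw [hW']; exact map_mk_int 0 1 0 (-392) 77044
  -- prime support of the two discriminants
  have hΔE : ∀ q : ℕ, q.Prime → (q : ℤ) ∣ (⟨0, 1, 0, (-4491824), (-94543873196)⟩ : WeierstrassCurve ℤ).Δ → q ∈ [2, 3, 107] :=
    X11b.forall_mem_of_natAbs_eq_prod_pow [2, 3, 107] [21, 0, 9]
      (by intro q hq; simp only [List.mem_cons, List.mem_nil_iff, or_false] at hq; rcases hq with rfl | rfl | rfl <;> norm_num)
      (by decide +kernel)
  have hΔF : ∀ q : ℕ, q.Prime → (q : ℤ) ∣ (⟨0, 1, 0, (-392), 77044⟩ : WeierstrassCurve ℤ).Δ → q ∈ [2, 3, 107] :=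
    X11b.forall_mem_of_natAbs_eq_prod_pow [2, 3, 107] [21, 0, 3]
      (by intro q hq; simp only [List.mem_cons, List.mem_nil_iff, or_false] at hq; rcases hq with rfl | rfl | rfl <;> norm_num)
      (by decide +kernel)
  refine exists_sha_ne_zero_three_of_congr_goodAtThree_rankTwo_of_primeList W W' θ hθ hE hF [2, 3, 107] (by simp)
    hΔE hΔF
    (by decide +kernel) (by decide +kernel) hfin hcop hrank (fun v hvL hv3 ↦ ?_)
  simp only [List.mem_cons, List.mem_nil_iff, or_false] at hvL
  rcases hvL with h2 | h3 | h107
  · -- `v = 2`: additive Kodaira I*ₙ, value set {2,4}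
    exact LocalTorsionAway.natCard_ker_nsmul_adicCompletion_eq_one_of_intModel_of_additive_tamLocal_forall hI' 2 3
      (by norm_num) h2 (by decide) (by decide) (E := ⟨2, 1, 5, 0, 190, 1, 384, 21, 71, 6, 4⟩) rfl
      tamLocal_check_183184a1_2 (by decide)
  · exact absurd h3 hv3
  · -- `v = 107`: additive type III, `c = 2`
    exact LocalTorsionAway.natCard_ker_nsmul_adicCompletion_eq_one_of_intModel_of_additive hI' 107 3 (by norm_num) h107
      (by decide) (by decide)
      (IntModelTam.localTamagawaNumber_padic_eq_of_intModel_of_tamLocal hI' 107 (E := ⟨107, 10, 4, 0, 71, 0, 0, 3, 3, 2, 2⟩)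
        rfl tamLocal_check_183184a1_107 (c := 2) (by decide)) (by norm_num)

/-- **`3² ∣ #Ш(183184b1)[3^∞]`** from the visible element (unconditional at `3`) and the Cassels–Tate parity (`hCT`).
[cite: SilvermanAEC2009, Thm. X.4.14] [cite: MilneADT2006, Ch. I Prop. 3.8] -/
theorem sq_dvd_card_sha_three_selfTwist_uncond_v183184b1
    (hCT : exists_casselsTate_pairing (K := ℚ))
    (hGZK : rank_eq_analyticRank_of_analyticRank_le_one)
    (W : WeierstrassCurve ℚ) [W.IsElliptic] [W.IsGloballyMinimal]
    (hI : integralModelInt W = ⟨0, 1, 0, (-4491824), (-94543873196)⟩) (hr : W.analyticRank = 0)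
    (W' : WeierstrassCurve ℚ) (hW' : W' = ⟨0, 1, 0, (-392), 77044⟩) [W'.IsElliptic]
    (θ : geomTorsion W' ((3 : ℕ) : ℤ) ≃+ geomTorsion W ((3 : ℕ) : ℤ))
    (hθ : ∀ (σ : Field.absoluteGaloisGroup ℚ) (P : geomTorsion W' ((3 : ℕ) : ℤ)), θ (σ • P) = σ • θ P)
    (hrank : 2 ≤ W'.mordellWeilRank) :
    3 ^ 2 ∣ Nat.card (AddCommGroup.primaryComponent W.sha 3) := by
  haveI : Finite W.sha := (hGZK W (by rw [hr]; exact zero_le_one)).2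
  exact Visible.sq_dvd_card_sha_three_of_exists_sha_torsion hCT W
    (exists_sha_three_selfTwist_uncond_v183184b1 hGZK W hI hr W' hW' θ hθ hrank)

/-- **The typed LOWER binder `MissingLowerBoundAt E 3` for `183184b1`** (`ord₃ #Ш_an ≤ ord₃ #Ш`) from the visible
`3`-torsion element, the Cassels–Tate squareness and the analytic datum `#Ш_an = 9` (`hq`, Cremona `allbsd`;
evidence binder). Conditional on `hCT` only at this step. [cite: SilvermanAEC2009, Thm. X.4.14] [cite: Cremona2006, Table 1 (label 183184b1)] -/
theorem missingLowerBoundAt_three_selfTwist_uncond_v183184b1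
    (hCT : exists_casselsTate_pairing (K := ℚ))
    (hGZK : rank_eq_analyticRank_of_analyticRank_le_one)
    (W : WeierstrassCurve ℚ) [W.IsElliptic] [W.IsGloballyMinimal]
    (hI : integralModelInt W = ⟨0, 1, 0, (-4491824), (-94543873196)⟩) (hr : W.analyticRank = 0)
    {q : ℚ} (hq : shaAn W = (q : ℂ)) (hv : padicValRat 3 q ≤ 2)
    (W' : WeierstrassCurve ℚ) (hW' : W' = ⟨0, 1, 0, (-392), 77044⟩) [W'.IsElliptic]
    (θ : geomTorsion W' ((3 : ℕ) : ℤ) ≃+ geomTorsion W ((3 : ℕ) : ℤ))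
    (hθ : ∀ (σ : Field.absoluteGaloisGroup ℚ) (P : geomTorsion W' ((3 : ℕ) : ℤ)), θ (σ • P) = σ • θ P)
    (hrank : 2 ≤ W'.mordellWeilRank) :
    haveI : Fact (Nat.Prime 3) := ⟨Nat.prime_three⟩
    MissingLowerBoundAt W 3 := by
  haveI : Fact (Nat.Prime 3) := ⟨Nat.prime_three⟩
  have hvis := exists_sha_three_selfTwist_uncond_v183184b1 hGZK W hI hr W' hW' θ hθ hrank
  exact missingLowerBoundAt_of_casselsTate_of_pow_dvd W 3 hCT (hGZK W (by rw [hr]; exact zero_le_one)).2 hq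
    (k := 1) (by simpa using hv) (by simpa using dvd_shaOrder_of_exists_torsion W 3 hvis)


end Summit.BirchSwinnertonDyer.Rank1Residual.X10.SelfTwist

end
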